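import Mathlib
import HarnessLib
import Literature.Analysis.FluidPDE.SelfSimilar
import Literature.Analysis.FluidPDE.VectorCalculusProofs
import Literature.Analysis.FluidPDE.AxisymHouLiVariables
import Literature.Analysis.FluidPDE.TaoEnstrophyLocalisation
import Summits.NavierStokesRegularity.NavierStokesRegularity.Theorems.HalfSpaceWindowDoorCirculationCarryingRigidityPlaneFlux
import Summits.NavierStokesRegularity.NavierStokesRegularity.Theorems.HalfSpaceWindowDoorCirculationCarryingRigidityTiltingFlux
import Summits.NavierStokesRegularity.NavierStokesRegularity.Theorems.ChiralWindowDoorClassDerivDecay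
import Summits.NavierStokesRegularity.NavierStokesRegularity.Theorems.HalfSpaceWindowDoorCirculationCarryingRigidityPlaneFluxHeightWindow

/-!
# Route `HalfSpaceWindowDoor`, crux `CirculationCarryingRigidity` (stmt-NavierStokesRegularity-25311) — the PLANE CIRCULATION
# of a closed-hemisphere profile with SPACE–TIME Type-I decay is INDEPENDENT OF THE HEIGHT (kinematic half of the plane-flux law)

g0's `…PlaneFlux.planeFlux_le_of_class_of_hasTypeIDecay`: in the space–time Type-I subclass (`HasTypeIDecay D`) of the route's
class, the closed-hemisphere sign makes the plane flux `Φ(c,s) = ∫_{x₃ = c} ⟪curl v(s), e₃⟫` FINITE (`≤ 4πD`).  This file proves the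
kinematic half of the planner's «plane-flux heat law»: `Φ(c,s)` does not depend on the height `c`.  Mechanism: `div curl v = 0`, so
`∂₃ω₃ = −∂₀ω₀ − ∂₁ω₁`; testing against the centred Gaussian window `g_{L,0}` and integrating by parts IN THE PLANE,
`∂_c ∫ ω₃(y,c) g_{L,0}(y) dy = ∫ ω_h(y,c)·∇g_{L,0}(y) dy`, and under the vorticity decay `‖curl v(x)‖(‖x‖+ρ)² ≤ A`
(`derivDecay_of_class`) this is `≤ (A/L²)·J(L)` with `J(L) = ∫ g_{L,0}(y)/(‖y‖+ρ) dy ≤ 1/R + eR²/(4ρL²)` for every `R > 0`;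
so `4πL²·|Ψ_L(c₂) − Ψ_L(c₁)| → 0` as `L → ∞`, while `4πL² Ψ_L(c) ↑ Φ(c)` (monotone convergence; the SIGN is what makes the plane
integral absolutely convergent — `|ω| ∼ |x|⁻²` is not integrable on a plane without it).

* (lemmas: `…PlaneFluxHeightWindow` — height derivative of the windowed flux and its decay bound;)
* `planeFlux_eq_of_decay` — kinematic: a `C²` field `V` with bounded `DV`, `D(curl V)`, velocity decay `‖V(x)‖(‖x‖+ρ) ≤ D`, vorticity
  decay `‖curl V(x)‖(‖x‖+ρ)² ≤ A` and `⟪curl V, e₃⟫ ≥ 0` has `∫⁻_{ℝ²} ⟪curl V(y,c₁), e₃⟫ dy = ∫⁻_{ℝ²} ⟪curl V(y,c₂), e₃⟫ dy`;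
* `planeFlux_eq_of_class_of_hasTypeIDecay` — the class form: for a closed-hemisphere profile of the route's Type-I class with
  space–time decay constant `D`, `Φ(c₁,s) = Φ(c₂,s)` for all `s < 0`, `c₁`, `c₂` (and `Φ ≤ 4πD`, g0).

The dynamic half (`Φ` independent of `s`) is the balance law `…VorticityBalance.hasDerivAt_integral_mul_inner_curl` tested with
`χ(x₃)η_R(x_h)`: the `χ′`-terms cancel identically (`ω₃v₃ − v₃ω₃ = 0`) and the `η_R`-terms vanish as `R → ∞` under the same decay —
not typed here.  Seat ns-hsw-p1 g2 (LEAD of 25311, cell pub-ns-dss).  WHAT THIS IS NOT: not a statement about Navier–Stokes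
regularity; a-priori structure of HYPOTHETICAL blow-up profiles in a subclass; helper `--supports` 25311.
-/

noncomputable section

-- the summit and its single sub-problem share the name (CONVENTIONS §1), as in every Theorems file
set_option linter.dupNamespace false

namespace Summit.NavierStokesRegularity.NavierStokesRegularity.Theorems.HalfSpaceWindowDoorCirculationCarryingRigidityPlaneFluxHeight

open MeasureTheory Set Function Filter Topology Metric
open scoped RealInnerProductSpace InnerProductSpace ENNReal
open Literature.Analysis Literature.Analysis.FluidPDE Literature.Analysis.UnboundedOperators
open Summit.NavierStokesRegularity.NavierStokesRegularity.Theorems.HalfSpaceWindowDoorCirculationCarryingRigidityDefs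
open Summit.NavierStokesRegularity.NavierStokesRegularity.Theorems.HalfSpaceWindowDoorCirculationCarryingRigidityWindowedFlux
  (gaussWin_pos continuous_gaussWin integrable_gaussWin continuous_planePt)
open Summit.NavierStokesRegularity.NavierStokesRegularity.Theorems.HalfSpaceWindowDoorCirculationCarryingRigidityPlaneFlux
  (norm_le_norm_planePt abs_fderiv_gaussWin_zero_apply_le integral_gaussWin_zero abs_integral_inner_curl_e3_mul_gaussWin_le_of_decay
    planeFlux_le_of_decay)
open Summit.NavierStokesRegularity.NavierStokesRegularity.Theorems.HalfSpaceWindowDoorCirculationCarryingRigidityTiltingFlux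
  (integral_fderiv_planePt_mul_gaussWin)
open Summit.NavierStokesRegularity.NavierStokesRegularity.Theorems.LocalSineTubeDoorProfileAlignedWindowRigidityAncient
  (bdd_of_hasTypeITimeDecay analyticOnNhd_slice)
open Summit.NavierStokesRegularity.NavierStokesRegularity.Theorems.PoloidalWindowDoorPoloidalWindowRigidityClassSpaceTimeRates
  (exists_fderiv_rate_of_class' exists_iteratedFDeriv_two_rate_of_class')
open Summit.NavierStokesRegularity.NavierStokesRegularity.Theorems.ChiralWindowDoorClassDerivDecay (derivDecay_of_class)
open Summit.NavierStokesRegularity.NavierStokesRegularity.Theorems.HalfSpaceWindowDoorCirculationCarryingRigidityPlaneFluxHeightWindow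


section Kinematic

variable {V : EuclideanSpace ℝ (Fin 3) → EuclideanSpace ℝ (Fin 3)}

/-! ### Monotone convergence and the height independence -/

/-- The plane `e₃`-vorticity slice of the sign class under velocity decay is (really) integrable and its integral is the
limit of the scaled windowed fluxes `∫ ω₃(y,c) e^{−‖y‖²/(4(n+1)²)} dy`. -/
theorem tendsto_windowedFlux_planeFlux (hV2 : ContDiff ℝ 2 V) {M D ρ : ℝ} (hM : ∀ x, ‖fderiv ℝ V x‖ ≤ M) (hρ : 0 < ρ)
    (hD : ∀ x, ‖V x‖ * (‖x‖ + ρ) ≤ D) (hnn : ∀ x, 0 ≤ ⟪curl V x, e3⟫) (c : ℝ) :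
    Integrable (fun y : EuclideanSpace ℝ (Fin 2) => ⟪curl V (planePt c y), e3⟫) ∧
      Tendsto (fun n : ℕ => 4 * Real.pi * ((n : ℝ) + 1) ^ 2 *
          ∫ y, ⟪curl V (planePt c y), e3⟫ * gaussWin ((n : ℝ) + 1) 0 y) atTop
        (𝓝 (∫ y : EuclideanSpace ℝ (Fin 2), ⟪curl V (planePt c y), e3⟫)) := by
  have hVd : Differentiable ℝ V := hV2.differentiable two_ne_zero
  have hVc : Continuous (fderiv ℝ V) := hV2.continuous_fderiv two_ne_zero
  have hWc : Continuous (curl V) := (contDiff_one_curl hV2).continuous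
  have hω_cont : Continuous fun y : EuclideanSpace ℝ (Fin 2) => ⟪curl V (planePt c y), e3⟫ :=
    (hWc.comp (continuous_planePt c)).inner continuous_const
  -- integrability from the finiteness of the plane flux (g0) and the sign
  have hfin := planeFlux_le_of_decay hVd hVc hM hρ hD hnn c
  have hint : Integrable (fun y : EuclideanSpace ℝ (Fin 2) => ⟪curl V (planePt c y), e3⟫) := by
    refine ⟨hω_cont.aestronglyMeasurable, ?_⟩
    rw [hasFiniteIntegral_iff_enorm]
    have h : ∫⁻ y, ‖⟪curl V (planePt c y), e3⟫‖ₑ = ∫⁻ y, ENNReal.ofReal ⟪curl V (planePt c y), e3⟫ :=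
      lintegral_congr fun y => by rw [Real.enorm_eq_ofReal (hnn _)]
    rw [h]
    exact lt_of_le_of_lt hfin ENNReal.ofReal_lt_top
  refine ⟨hint, ?_⟩
  -- the approximants
  have hfac : ∀ (n : ℕ) (y : EuclideanSpace ℝ (Fin 2)), 4 * Real.pi * ((n : ℝ) + 1) ^ 2 *
      (⟪curl V (planePt c y), e3⟫ * gaussWin ((n : ℝ) + 1) 0 y) =
        ⟪curl V (planePt c y), e3⟫ * Real.exp (-‖y‖ ^ 2 / (4 * ((n : ℝ) + 1) ^ 2)) := by
    intro n y
    rw [gaussWin, sub_zero]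
    have : (0 : ℝ) < (n : ℝ) + 1 := by positivity
    field_simp
  have hexp_le : ∀ (n : ℕ) (y : EuclideanSpace ℝ (Fin 2)), Real.exp (-‖y‖ ^ 2 / (4 * ((n : ℝ) + 1) ^ 2)) ≤ 1 := by
    intro n y
    rw [Real.exp_le_one_iff, neg_div]
    exact neg_nonpos.2 (by positivity)
  have hfn_int : ∀ n : ℕ, Integrable (fun y : EuclideanSpace ℝ (Fin 2) =>
      ⟪curl V (planePt c y), e3⟫ * Real.exp (-‖y‖ ^ 2 / (4 * ((n : ℝ) + 1) ^ 2))) := by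
    intro n
    refine Integrable.mono' hint ?_ (ae_of_all _ fun y => ?_)
    · exact (hω_cont.mul (Real.continuous_exp.comp (((continuous_norm.pow 2).neg).div_const _))).aestronglyMeasurable
    · rw [norm_mul, Real.norm_eq_abs, Real.norm_eq_abs, abs_of_nonneg (hnn _), abs_of_pos (Real.exp_pos _)]
      exact mul_le_of_le_one_right (hnn _) (hexp_le n y)
  have hmono : ∀ᵐ y ∂(volume : Measure (EuclideanSpace ℝ (Fin 2))), Monotone fun n : ℕ =>
      ⟪curl V (planePt c y), e3⟫ * Real.exp (-‖y‖ ^ 2 / (4 * ((n : ℝ) + 1) ^ 2)) := by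
    refine ae_of_all _ fun y m n hmn => ?_
    apply mul_le_mul_of_nonneg_left _ (hnn _)
    apply Real.exp_le_exp.2
    rw [neg_div, neg_div, neg_le_neg_iff]
    have hmn' : (m : ℝ) + 1 ≤ (n : ℝ) + 1 := by
      have : (m : ℝ) ≤ n := by exact_mod_cast hmn
      linarith
    exact div_le_div_of_nonneg_left (sq_nonneg _) (by positivity) (by gcongr)
  have htend : ∀ᵐ y ∂(volume : Measure (EuclideanSpace ℝ (Fin 2))), Tendsto (fun n : ℕ =>
      ⟪curl V (planePt c y), e3⟫ * Real.exp (-‖y‖ ^ 2 / (4 * ((n : ℝ) + 1) ^ 2))) atTop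
      (𝓝 ⟪curl V (planePt c y), e3⟫) := by
    refine ae_of_all _ fun y => ?_
    have hden : Tendsto (fun n : ℕ => 4 * ((n : ℝ) + 1) ^ 2) atTop atTop := by
      have h1 : Tendsto (fun n : ℕ => (n : ℝ) + 1) atTop atTop :=
        tendsto_atTop_add_const_right _ _ tendsto_natCast_atTop_atTop
      exact ((tendsto_pow_atTop two_ne_zero).comp h1).const_mul_atTop (by norm_num)
    have h1 : Tendsto (fun n : ℕ => -‖y‖ ^ 2 / (4 * ((n : ℝ) + 1) ^ 2)) atTop (𝓝 0) :=
      tendsto_const_nhds.div_atTop hden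
    have h2 : Tendsto (fun n : ℕ => Real.exp (-‖y‖ ^ 2 / (4 * ((n : ℝ) + 1) ^ 2))) atTop (𝓝 1) := by
      have h := (Real.continuous_exp.tendsto 0).comp h1
      rwa [Real.exp_zero] at h
    simpa using h2.const_mul ⟪curl V (planePt c y), e3⟫
  have hlim := integral_tendsto_of_tendsto_of_monotone hfn_int hint hmono htend
  refine hlim.congr fun n => ?_
  rw [← integral_const_mul]
  exact integral_congr_ae (ae_of_all _ fun y => (hfac n y).symm)

/-- **PLANE CIRCULATION IS INDEPENDENT OF THE HEIGHT (kinematic form).**  Let `V` be a `C²` field on `ℝ³` with `‖DV‖ ≤ M`,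
`‖D(curl V)‖ ≤ M₂`, velocity decay `‖V(x)‖(‖x‖+ρ) ≤ D`, vorticity decay `‖curl V(x)‖(‖x‖+ρ)² ≤ A` (`ρ > 0`) and the
closed-hemisphere sign `⟪curl V, e₃⟫ ≥ 0`.  Then the (finite) plane flux `∫_{ℝ²} ⟪curl V(y,c), e₃⟫ dy` does not depend on `c`
(real-integral form). -/
theorem integral_planeFlux_eq_of_decay (hV2 : ContDiff ℝ 2 V) {M M₂ D A ρ : ℝ} (hM : ∀ x, ‖fderiv ℝ V x‖ ≤ M)
    (hM₂ : ∀ x, ‖fderiv ℝ (curl V) x‖ ≤ M₂) (hρ : 0 < ρ) (hD : ∀ x, ‖V x‖ * (‖x‖ + ρ) ≤ D)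
    (hA : ∀ x, ‖curl V x‖ * (‖x‖ + ρ) ^ 2 ≤ A) (hnn : ∀ x, 0 ≤ ⟪curl V x, e3⟫) (c₁ c₂ : ℝ) :
    ∫ y : EuclideanSpace ℝ (Fin 2), ⟪curl V (planePt c₁ y), e3⟫ = ∫ y : EuclideanSpace ℝ (Fin 2), ⟪curl V (planePt c₂ y), e3⟫ := by
  have hA0 : 0 ≤ A := le_trans (by positivity) (hA 0)
  -- a uniform vorticity bound from the decay
  have hB₁ : ∀ x, ‖curl V x‖ ≤ A / ρ ^ 2 := by
    intro x
    rw [le_div_iff₀ (by positivity)]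
    calc ‖curl V x‖ * ρ ^ 2 ≤ ‖curl V x‖ * (‖x‖ + ρ) ^ 2 := by
          gcongr
          exact le_add_of_nonneg_left (norm_nonneg _)
      _ ≤ A := hA x
  obtain ⟨-, h1⟩ := tendsto_windowedFlux_planeFlux hV2 hM hρ hD hnn c₁
  obtain ⟨-, h2⟩ := tendsto_windowedFlux_planeFlux hV2 hM hρ hD hnn c₂
  -- the difference of the approximants tends to `0`
  have hdiff : Tendsto (fun n : ℕ => 4 * Real.pi * ((n : ℝ) + 1) ^ 2 *
      (∫ y, ⟪curl V (planePt c₂ y), e3⟫ * gaussWin ((n : ℝ) + 1) 0 y) -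
        4 * Real.pi * ((n : ℝ) + 1) ^ 2 * (∫ y, ⟪curl V (planePt c₁ y), e3⟫ * gaussWin ((n : ℝ) + 1) 0 y)) atTop (𝓝 0) := by
    -- the bound `4πA (1/√L + e/(4ρL)) |c₂ − c₁|` with `L = n + 1`, `R = √L`
    have hbd : ∀ n : ℕ, |4 * Real.pi * ((n : ℝ) + 1) ^ 2 *
        (∫ y, ⟪curl V (planePt c₂ y), e3⟫ * gaussWin ((n : ℝ) + 1) 0 y) -
          4 * Real.pi * ((n : ℝ) + 1) ^ 2 * (∫ y, ⟪curl V (planePt c₁ y), e3⟫ * gaussWin ((n : ℝ) + 1) 0 y)| ≤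
        4 * Real.pi * A * (1 / Real.sqrt ((n : ℝ) + 1) + Real.exp 1 * (Real.sqrt ((n : ℝ) + 1)) ^ 2 /
          (4 * ρ * ((n : ℝ) + 1) ^ 2)) * |c₂ - c₁| := by
      intro n
      have hL : (0 : ℝ) < (n : ℝ) + 1 := by positivity
      exact abs_sub_windowedFlux_le hV2 hB₁ hM₂ hρ hA hL (Real.sqrt_pos.2 hL) c₁ c₂
    have hε : Tendsto (fun n : ℕ => 4 * Real.pi * A * (1 / Real.sqrt ((n : ℝ) + 1) +
        Real.exp 1 * (Real.sqrt ((n : ℝ) + 1)) ^ 2 / (4 * ρ * ((n : ℝ) + 1) ^ 2)) * |c₂ - c₁|) atTop (𝓝 0) := by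
      have hn1 : Tendsto (fun n : ℕ => (n : ℝ) + 1) atTop atTop :=
        tendsto_atTop_add_const_right _ _ tendsto_natCast_atTop_atTop
      have ha : Tendsto (fun n : ℕ => 1 / Real.sqrt ((n : ℝ) + 1)) atTop (𝓝 0) := by
        have h := (Real.tendsto_sqrt_atTop.comp hn1)
        exact tendsto_const_nhds.div_atTop h
      have hb : Tendsto (fun n : ℕ => Real.exp 1 * (Real.sqrt ((n : ℝ) + 1)) ^ 2 / (4 * ρ * ((n : ℝ) + 1) ^ 2))
          atTop (𝓝 0) := by
        have hfun : (fun n : ℕ => Real.exp 1 * (Real.sqrt ((n : ℝ) + 1)) ^ 2 / (4 * ρ * ((n : ℝ) + 1) ^ 2)) =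
            fun n : ℕ => (Real.exp 1 / (4 * ρ)) / ((n : ℝ) + 1) := by
          funext n
          have hL : (0 : ℝ) < (n : ℝ) + 1 := by positivity
          rw [Real.sq_sqrt hL.le]
          field_simp
        rw [hfun]
        exact tendsto_const_nhds.div_atTop hn1
      have h := ((ha.add hb).const_mul (4 * Real.pi * A)).mul_const |c₂ - c₁|
      simpa using h
    exact squeeze_zero_norm (fun n => by rw [Real.norm_eq_abs]; exact hbd n) hε
  have hsub := h2.sub h1
  have h0 := tendsto_nhds_unique hsub hdiff
  linarith

/-- **PLANE CIRCULATION IS INDEPENDENT OF THE HEIGHT (lower-integral form)**: under the hypotheses of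
`integral_planeFlux_eq_of_decay`, `∫⁻_{ℝ²} ⟪curl V(y,c₁), e₃⟫ dy = ∫⁻_{ℝ²} ⟪curl V(y,c₂), e₃⟫ dy`. -/
theorem planeFlux_eq_of_decay (hV2 : ContDiff ℝ 2 V) {M M₂ D A ρ : ℝ} (hM : ∀ x, ‖fderiv ℝ V x‖ ≤ M)
    (hM₂ : ∀ x, ‖fderiv ℝ (curl V) x‖ ≤ M₂) (hρ : 0 < ρ) (hD : ∀ x, ‖V x‖ * (‖x‖ + ρ) ≤ D)
    (hA : ∀ x, ‖curl V x‖ * (‖x‖ + ρ) ^ 2 ≤ A) (hnn : ∀ x, 0 ≤ ⟪curl V x, e3⟫) (c₁ c₂ : ℝ) :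
    ∫⁻ y : EuclideanSpace ℝ (Fin 2), ENNReal.ofReal ⟪curl V (planePt c₁ y), e3⟫ =
      ∫⁻ y : EuclideanSpace ℝ (Fin 2), ENNReal.ofReal ⟪curl V (planePt c₂ y), e3⟫ := by
  obtain ⟨h1, -⟩ := tendsto_windowedFlux_planeFlux hV2 hM hρ hD hnn c₁
  obtain ⟨h2, -⟩ := tendsto_windowedFlux_planeFlux hV2 hM hρ hD hnn c₂
  rw [← ofReal_integral_eq_lintegral_ofReal h1 (ae_of_all _ fun y => hnn _),
    ← ofReal_integral_eq_lintegral_ofReal h2 (ae_of_all _ fun y => hnn _),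
    integral_planeFlux_eq_of_decay hV2 hM hM₂ hρ hD hA hnn c₁ c₂]

end Kinematic

/-! ### The class form -/

/-- `‖D(curl V)(x)‖ ≤ ‖curlCLM‖ ‖D²V(x)‖` for a `C²` field. -/
theorem norm_fderiv_curl_le {V : EuclideanSpace ℝ (Fin 3) → EuclideanSpace ℝ (Fin 3)} (hV2 : ContDiff ℝ 2 V)
    (x : EuclideanSpace ℝ (Fin 3)) : ‖fderiv ℝ (curl V) x‖ ≤ ‖curlCLM‖ * ‖iteratedFDeriv ℝ 2 V x‖ := by
  have hD : DifferentiableAt ℝ (fderiv ℝ V) x :=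
    ((hV2.fderiv_right (m := 1) le_rfl).differentiable one_ne_zero) x
  rw [curl_eq_curlCLM_comp, (curlCLM.hasFDerivAt.comp x hD.hasFDerivAt).fderiv, ← norm_iteratedFDeriv_fderiv,
    norm_iteratedFDeriv_one]
  exact ContinuousLinearMap.opNorm_comp_le _ _

/-- **PLANE CIRCULATION OF A CLOSED-HEMISPHERE SPACE–TIME TYPE-I PROFILE IS INDEPENDENT OF THE HEIGHT.**  For a profile of the
route's Type-I ancient Oseen-mild class (rate `C`, continuity, Oseen–Duhamel identity, divergence-free slices) with SPACE–TIME
Type-I decay `‖v(t,x)‖ ≤ D/(‖x‖+√(−t))` and the sign `⟪curl v(s), e₃⟫ ≥ 0`: for every `s < 0` and heights `c₁, c₂`,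
`∫⁻_{ℝ²} ⟪curl v(s)(y,c₁), e₃⟫ dy = ∫⁻_{ℝ²} ⟪curl v(s)(y,c₂), e₃⟫ dy` (both `≤ 4πD`, g0's `planeFlux_le_of_class_of_hasTypeIDecay`).
The slices are `C²` with class rates (`exists_fderiv_rate_of_class'`, `exists_iteratedFDeriv_two_rate_of_class'`) and the vorticity
decays like `(‖x‖+√(−s))⁻²` (`derivDecay_of_class`), so `planeFlux_eq_of_decay` applies with `ρ = √(−s)`. -/
theorem planeFlux_eq_of_class_of_hasTypeIDecay :
    ∀ (C D : ℝ) (v : ℝ → EuclideanSpace ℝ (Fin 3) → EuclideanSpace ℝ (Fin 3)),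
    Literature.Analysis.FluidPDE.HasTypeITimeDecay C v → Literature.Analysis.FluidPDE.HasTypeIDecay D v →
    ContinuousOn (Function.uncurry v) (Set.Iio (0 : ℝ) ×ˢ Set.univ) →
    (∀ s t : ℝ, s < t → t < 0 → ∀ x, v t x =
      Literature.Analysis.UnboundedOperators.heatExtension (v s) (t - s) x -
        Literature.Analysis.FluidPDE.oseenDuhamel 1 s v v t x) →
    (∀ t < 0, Literature.Analysis.FluidPDE.VectorCalculus.IsDivFree (v t)) →
    (∀ s < 0, ∀ y, 0 ≤ ⟪Literature.Analysis.FluidPDE.curl (v s) y, e3⟫_ℝ) →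
    ∀ s < 0, ∀ c₁ c₂ : ℝ,
      ∫⁻ y, ENNReal.ofReal ⟪Literature.Analysis.FluidPDE.curl (v s) (planePt c₁ y), e3⟫_ℝ =
        ∫⁻ y, ENNReal.ofReal ⟪Literature.Analysis.FluidPDE.curl (v s) (planePt c₂ y), e3⟫_ℝ := by
  intro C D v hrate hdec hcont hmild hdiv hnn s hs c₁ c₂
  -- smoothness of the slice
  have hA : AnalyticOnNhd ℝ (v s) univ := analyticOnNhd_slice hcont (bdd_of_hasTypeITimeDecay hrate) hmild hs
  have hV2 : ContDiff ℝ 2 (v s) := contDiff_iff_contDiffAt.2 fun x => (hA x (mem_univ x)).contDiffAt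
  -- class rates
  obtain ⟨K₁, -, hK₁⟩ := exists_fderiv_rate_of_class' hrate hcont hmild
  obtain ⟨K₂, -, hK₂⟩ := exists_iteratedFDeriv_two_rate_of_class' hrate hcont hmild
  have hM₂ : ∀ x, ‖fderiv ℝ (curl (v s)) x‖ ≤ ‖curlCLM‖ * (K₂ / ((-s) * Real.sqrt (-s))) := fun x =>
    (norm_fderiv_curl_le hV2 x).trans (mul_le_mul_of_nonneg_left (hK₂ s hs x) (norm_nonneg curlCLM))
  -- decay
  have hρ : 0 < Real.sqrt (-s) := Real.sqrt_pos.2 (neg_pos.2 hs)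
  have hD : ∀ x, ‖v s x‖ * (‖x‖ + Real.sqrt (-s)) ≤ D := by
    intro x
    have h := hdec s hs x
    have hpos : 0 < ‖x‖ + Real.sqrt (-s) := by positivity
    rwa [le_div_iff₀ hpos] at h
  obtain ⟨K, hK⟩ := derivDecay_of_class C D v hrate hdec hcont hmild hdiv
  have hAd : ∀ x, ‖curl (v s) x‖ * (‖x‖ + Real.sqrt (-s)) ^ 2 ≤ 4 * K := by
    intro x
    obtain ⟨h1, -, -⟩ := hK s hs x
    calc ‖curl (v s) x‖ * (‖x‖ + Real.sqrt (-s)) ^ 2 ≤ (4 * ‖fderiv ℝ (v s) x‖) * (‖x‖ + Real.sqrt (-s)) ^ 2 := by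
          gcongr; exact norm_curl_le_four_mul (v s) x
      _ = 4 * ((‖x‖ + Real.sqrt (-s)) ^ 2 * ‖fderiv ℝ (v s) x‖) := by ring
      _ ≤ 4 * K := by linarith
  exact planeFlux_eq_of_decay hV2 (hK₁ s hs) hM₂ hρ hD hAd (hnn s hs) c₁ c₂

end Summit.NavierStokesRegularity.NavierStokesRegularity.Theorems.HalfSpaceWindowDoorCirculationCarryingRigidityPlaneFluxHeight

end
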